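import Mathlib.Analysis.SpecialFunctions.Integrals.Basic
import Mathlib.MeasureTheory.Integral.IntervalIntegral.FundThmCalculus
import Mathlib.Analysis.SpecialFunctions.Trigonometric.Deriv
import Mathlib.Analysis.SpecialFunctions.ExpDeriv
import HarnessLib

/-!
# The one-variable Stein / Schwinger–Dyson identity on a period, and the von Mises link law

HONEST FRAMING: exact (Metropolis-corrected) sampling algorithms for lattice gauge theory;
figures of merit are autocorrelation/cost numbers at stated couplings and volumes; no
continuum-physics claim.

Venture `LatticeQCDFlow` (cell pub-lqcd), sub-topic `Exactness`; FANOUT row 9 (`eng-latcore`, the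
lattice Monte Carlo core `latflow.core`).  NEW WORK of the cell (our own statement and proof; the
general lattice statement is the Schwinger–Dyson / Makeenko–Migdal identity, named, not cited as a
tree fact).

## What is typed and why

`latflow.core.schwinger_dyson` (release 0.2.4 / 0.2.5) writes, per stored configuration, residuals
`R` with `⟨R⟩ = 0` EXACTLY under the target law — a reference-free exactness observable for chains
whose target has no tabulated exact value (4-d SU(N) at unlisted couplings; the 2-d CP(N−1) rung; the
interacting φ⁴ rung).  Every one of those identities is an INTEGRATION BY PARTS IN ONE VARIABLE with
the others frozen: for the U(1) gauge links and the CP(N−1) links the variable is an angle `θ` on a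
period and the conditional law is von Mises, `∝ e^{κ cos(θ − α)}` (`κ = β |staple sum|` resp.
`2Nβ |G|`, `α` = its phase); for SU(N) it is a left-invariant vector field on the group; for φ⁴ a
real line.  This file kernel-checks the circle case in the generality the engine uses:

* `integral_deriv_periodic_eq_zero` — if `F` has derivative `f` on `[a, a + T]`, `f` is interval-
  integrable and `F a = F (a + T)`, then `∫_a^{a+T} f = 0` (FTC; the whole content of 'Stein on a
  period');
* **`stein_circle`** — for differentiable `S`, `h` (derivatives `S′`, `h′`, Stein integrand
  interval-integrable) and
  `h a · e^{−S a} = h (a+T) · e^{−S (a+T)}` (e.g. both `T`-periodic):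
  `∫_a^{a+T} (h′ θ − S′ θ · h θ) · e^{−S θ} dθ = 0` — the generator of the overdamped Langevin
  diffusion with stationary density `e^{−S}` has mean zero, for EVERY test function `h`;
* **`vonMises_stein_cos`** — the LINK LAW instance with arbitrary concentration `κ` and mean `α`:
  `∫_0^{2π} (cos(θ−α) − κ sin²(θ−α)) e^{κ cos(θ−α)} dθ = 0`, i.e. `⟨cos ψ⟩ = κ ⟨sin² ψ⟩`, ψ = θ − α
  — the real part of the engine's link residual `a + iκ (Im a) a`, `a = e^{iψ}` (up to the factor
  `|G|`), at every `κ`, `α`; row 11's `Scoring/SchwingerDysonOnePlaquette.integral_sdResidual_onePlaquette`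
  is the case `α = 0`, `κ = β`;
* `vonMises_stein_sin` — the imaginary part: `∫_0^{2π} (sin ψ + κ sin ψ cos ψ) e^{κ cos ψ} dθ = 0`
  (test function `h = −cos ψ`).

What is NOT here: the product-measure (many-link) statement, the SU(N) Haar statement, the sphere
(von Mises–Fisher) and real-line (φ⁴) instances, and anything about statistical power.
-/

namespace Summit.Ventures.LatticeQCDFlow.Exactness

open Real MeasureTheory intervalIntegral Set

/-- **FTC on a period.**  If `F` has derivative `f x` at every point of `[[a, a + T]]`, `f` is
interval-integrable there and `F` takes the same value at both ends, then `∫_a^{a+T} f = 0`. -/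
theorem integral_deriv_periodic_eq_zero {F f : ℝ → ℝ} {a T : ℝ}
    (hderiv : ∀ x ∈ uIcc a (a + T), HasDerivAt F (f x) x)
    (hint : IntervalIntegrable f volume a (a + T)) (hper : F a = F (a + T)) :
    ∫ x in a..(a + T), f x = 0 := by
  rw [integral_eq_sub_of_hasDerivAt hderiv hint, hper, sub_self]

/-- `d/dθ [h θ · e^{−S θ}] = (h′ θ − S′ θ · h θ) · e^{−S θ}` — the Stein integrand of the weight
`e^{−S}` and the test function `h`. -/
theorem hasDerivAt_mul_exp_neg {S S' h h' : ℝ → ℝ} {θ : ℝ}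
    (hS : HasDerivAt S (S' θ) θ) (hh : HasDerivAt h (h' θ) θ) :
    HasDerivAt (fun x => h x * Real.exp (-S x)) ((h' θ - S' θ * h θ) * Real.exp (-S θ)) θ := by
  have h1 : HasDerivAt (fun x => -S x) (-S' θ) θ := hS.neg
  have h2 : HasDerivAt (fun x => Real.exp (-S x)) (Real.exp (-S θ) * (-S' θ)) θ := h1.exp
  have h3 := hh.mul h2
  have heq : (h' θ - S' θ * h θ) * Real.exp (-S θ)
      = h' θ * Real.exp (-S θ) + h θ * (Real.exp (-S θ) * -S' θ) := by ring
  rw [heq]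
  exact h3

/-- **Stein's identity on a period (the one-variable Schwinger–Dyson / Langevin-generator identity).**
For `S`, `h` differentiable everywhere with derivatives `S'`, `h'`, the Stein integrand interval-
integrable on `[a, a+T]`, and the boundary values of `h · e^{−S}` equal (e.g. `S`, `h` both
`T`-periodic): `∫_a^{a+T} (h′ θ − S′ θ h θ) e^{−S θ} dθ = 0`. -/
theorem stein_circle {S S' h h' : ℝ → ℝ} {a T : ℝ}
    (hS : ∀ x, HasDerivAt S (S' x) x) (hh : ∀ x, HasDerivAt h (h' x) x)
    (hint : IntervalIntegrable (fun θ => (h' θ - S' θ * h θ) * Real.exp (-S θ)) volume a (a + T))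
    (hper : h a * Real.exp (-S a) = h (a + T) * Real.exp (-S (a + T))) :
    ∫ θ in a..(a + T), (h' θ - S' θ * h θ) * Real.exp (-S θ) = 0 :=
  integral_deriv_periodic_eq_zero (F := fun x => h x * Real.exp (-S x))
    (fun x _ => hasDerivAt_mul_exp_neg (hS x) (hh x)) hint hper

/-! ## The von Mises link law `∝ e^{κ cos(θ − α)}` (U(1) gauge links, CP(N−1) links) -/

/-- The von Mises 'action' `S(θ) = −κ cos(θ − α)` (weight `e^{−S} = e^{κ cos(θ − α)}`) has derivative
`S′(θ) = κ sin(θ − α)`. -/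
theorem hasDerivAt_vonMises (κ α θ : ℝ) :
    HasDerivAt (fun x => -(κ * Real.cos (x - α))) (κ * Real.sin (θ - α)) θ := by
  have h1 : HasDerivAt (fun x => x - α) 1 θ := (hasDerivAt_id θ).sub_const α
  have h2 : HasDerivAt (fun x => Real.cos (x - α)) (-Real.sin (θ - α) * 1) θ := h1.cos
  have h3 : HasDerivAt (fun x => -(κ * Real.cos (x - α))) (-(κ * (-Real.sin (θ - α) * 1))) θ :=
    (h2.const_mul κ).neg
  have heq : κ * Real.sin (θ - α) = -(κ * (-Real.sin (θ - α) * 1)) := by ring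
  rw [heq]; exact h3

/-- `d/dθ sin(θ − α) = cos(θ − α)`. -/
theorem hasDerivAt_sin_shift (α θ : ℝ) : HasDerivAt (fun x => Real.sin (x - α)) (Real.cos (θ - α)) θ := by
  have h1 : HasDerivAt (fun x => x - α) 1 θ := (hasDerivAt_id θ).sub_const α
  have h2 : HasDerivAt (fun x => Real.sin (x - α)) (Real.cos (θ - α) * 1) θ := h1.sin
  simpa using h2

/-- `d/dθ (−cos(θ − α)) = sin(θ − α)`. -/
theorem hasDerivAt_neg_cos_shift (α θ : ℝ) :
    HasDerivAt (fun x => -Real.cos (x - α)) (Real.sin (θ - α)) θ := by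
  have h1 : HasDerivAt (fun x => x - α) 1 θ := (hasDerivAt_id θ).sub_const α
  have h2 : HasDerivAt (fun x => -Real.cos (x - α)) (-(-Real.sin (θ - α) * 1)) θ := h1.cos.neg
  simpa using h2

/-- **`⟨cos ψ⟩ = κ ⟨sin² ψ⟩` for the von Mises law, at every concentration `κ` and mean `α`**
(`ψ = θ − α`): `∫_0^{2π} (cos(θ−α) − κ sin²(θ−α)) e^{κ cos(θ−α)} dθ = 0`.  Test function
`h = sin ψ` in `stein_circle`.  The real part of the engine's link residual
(`latflow.core.schwinger_dyson`: `Re a − κ (Im a)²`, `a = e^{iψ}`). -/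
theorem vonMises_stein_cos (κ α : ℝ) :
    ∫ θ in (0 : ℝ)..(0 + 2 * π),
      (Real.cos (θ - α) - κ * Real.sin (θ - α) ^ 2) * Real.exp (κ * Real.cos (θ - α)) = 0 := by
  have hmain := stein_circle (S := fun x => -(κ * Real.cos (x - α))) (S' := fun x => κ * Real.sin (x - α))
    (h := fun x => Real.sin (x - α)) (h' := fun x => Real.cos (x - α)) (a := 0) (T := 2 * π)
    (hasDerivAt_vonMises κ α) (hasDerivAt_sin_shift α) ?hint ?hper
  case hint =>
    exact (by fun_prop : Continuous fun θ => (Real.cos (θ - α) - κ * Real.sin (θ - α) * Real.sin (θ - α))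
      * Real.exp (-(-(κ * Real.cos (θ - α))))).intervalIntegrable _ _
  case hper =>
    rw [show (0 + 2 * π) - α = (0 - α) + 2 * π by ring, Real.sin_add_two_pi, Real.cos_add_two_pi]
  have hpt : (fun θ => (Real.cos (θ - α) - κ * Real.sin (θ - α) ^ 2) * Real.exp (κ * Real.cos (θ - α)))
      = fun θ => (Real.cos (θ - α) - κ * Real.sin (θ - α) * Real.sin (θ - α))
          * Real.exp (-(-(κ * Real.cos (θ - α)))) := by
    funext θ; rw [neg_neg]; ring
  rw [hpt]; exact hmain

/-- **The imaginary part: `⟨sin ψ (1 + κ cos ψ)⟩ = 0`** for the von Mises law (test function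
`h = −cos ψ`): `∫_0^{2π} (sin(θ−α) + κ sin(θ−α) cos(θ−α)) e^{κ cos(θ−α)} dθ = 0`.  (`Im a (1 + κ Re a)`
in the engine's notation.) -/
theorem vonMises_stein_sin (κ α : ℝ) :
    ∫ θ in (0 : ℝ)..(0 + 2 * π),
      (Real.sin (θ - α) + κ * Real.sin (θ - α) * Real.cos (θ - α)) * Real.exp (κ * Real.cos (θ - α))
        = 0 := by
  have hmain := stein_circle (S := fun x => -(κ * Real.cos (x - α))) (S' := fun x => κ * Real.sin (x - α))
    (h := fun x => -Real.cos (x - α)) (h' := fun x => Real.sin (x - α)) (a := 0) (T := 2 * π)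
    (hasDerivAt_vonMises κ α) (hasDerivAt_neg_cos_shift α) ?hint ?hper
  case hint =>
    exact (by fun_prop : Continuous fun θ => (Real.sin (θ - α) - κ * Real.sin (θ - α) * -Real.cos (θ - α))
      * Real.exp (-(-(κ * Real.cos (θ - α))))).intervalIntegrable _ _
  case hper =>
    rw [show (0 + 2 * π) - α = (0 - α) + 2 * π by ring, Real.cos_add_two_pi]
  have hpt : (fun θ => (Real.sin (θ - α) + κ * Real.sin (θ - α) * Real.cos (θ - α))
        * Real.exp (κ * Real.cos (θ - α)))
      = fun θ => (Real.sin (θ - α) - κ * Real.sin (θ - α) * -Real.cos (θ - α))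
          * Real.exp (-(-(κ * Real.cos (θ - α)))) := by
    funext θ; rw [neg_neg]; ring
  rw [hpt]; exact hmain

/-- The `α = 0`, `κ = β` case of `vonMises_stein_cos` is the one-plaquette identity of
`Scoring/SchwingerDysonOnePlaquette.lean` (`∫_0^{2π} (cos θ − β sin² θ) e^{β cos θ} dθ = 0`), stated
here on `0..2π` without importing that file. -/
theorem onePlaquette_stein (β : ℝ) :
    ∫ θ in (0 : ℝ)..(2 * π), (Real.cos θ - β * Real.sin θ ^ 2) * Real.exp (β * Real.cos θ) = 0 := by
  have h := vonMises_stein_cos β 0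
  simp only [sub_zero, zero_add] at h
  exact h

end Summit.Ventures.LatticeQCDFlow.Exactness
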